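import Summits.BirchSwinnertonDyer.BirchSwinnertonDyer.Theorems.KatoDescentTamePotSupersingularTameUpperDefectTowerSurj
import HarnessLib

/-!
# Route `KatoDescentTamePotSupersingular` (rung K8, sub-rung B4 (t′), cell `bsd-potss`): the GLUE
# item `TameUpperDefectOfSplit` (stmt-BirchSwinnertonDyer-19204) — the two row cruxes of the U₀
# reshape + the Kato–Tamagawa-exact inputs give the parent node `TameUpperDefectRankZero`
# (stmt-BirchSwinnertonDyer-19982) BY NAME

`TameUpperDefectOfSplit := TameUpperNonsurjTower → TameUpperReducibleDefect → KatoTamagawaExactInputs →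
TameUpperDefectRankZero`. Proof: destructure `KatoTamagawaExactInputs = A161″ ∧ GZK ∧ modularity`
and apply the reshaped composition `tameUpperDefectRankZero_of_nonsurj_of_redDefect_of_katoTam`
(`Theorems/KatoDescentTamePotSupersingularTameUpperDefectTowerSurj`, kmc g6, filed p416834): on an
irreducible tower-surjective rank-`0` (t′) row the Tamagawa-exact Kato bound A161″ gives the upper
half outright (`X4RankZero.missingUpperBoundAt_of_katoTam`), the irreducible NON-tower-surjective
rows are `TameUpperNonsurjTower` (item 19202) and the reducible defect rows are
`TameUpperReducibleDefect` (item 19203). Unconditional theorem of the glue decl's exact type (the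
two cruxes and the cite-only inputs sit in HYPOTHESIS position, as the item states them); certified
shape = the tenure planner's `plan/split-g9/KT_split_sketch.lean` (`tameUpperDefectRankZero_of_split`).
Seat `bsd-potss-k8t-c4`.

References: [Kato2004Asterisque] Thm. 14.5 (3) (p. 236), Prop. 14.16 (2) (p. 244), §14.8 (p. 238);
[GreenbergLNM1716] Prop. 4.13; [Miller2011LMS] Def. 1.1.
-/

set_option autoImplicit false
-- sibling precedent (`KatoDescentTamePotSupersingularAssembly.lean`): the directory name repeats the summit name
set_option linter.dupNamespace false

noncomputable section

namespace Summit.BirchSwinnertonDyer.BirchSwinnertonDyer.Theorems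

open Summit.BirchSwinnertonDyer.BirchSwinnertonDyer.Theses.KatoDescentTamePotSupersingular

/-- **GLUE of the U₀ reshape (item stmt-BirchSwinnertonDyer-19204), proved:** the row cruxes
`TameUpperNonsurjTower` (irreducible, `p`-adic tower not onto) and `TameUpperReducibleDefect`
(reducible defect rows) together with `KatoTamagawaExactInputs` (A161″ ∧ GZK ∧ modularity) give the
parent crux `TameUpperDefectRankZero` by name — the remaining irreducible tower-SURJECTIVE rows being
closed outright by the Tamagawa-exact Kato bound (`tameUpperDefectRankZero_of_nonsurj_of_redDefect_of_katoTam`).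
[cite: Kato2004Asterisque, Thm. 14.5 (3) (p. 236), Prop. 14.16 (2) (p. 244), §14.8 (p. 238)]
[cite: GreenbergLNM1716, §4 Prop. 4.13] -/
theorem tameUpperDefectOfSplit_proof :
    Summit.BirchSwinnertonDyer.BirchSwinnertonDyer.Theses.KatoDescentTamePotSupersingular.TameUpperDefectOfSplit := by
  intro h₁ h₂ h₃
  exact tameUpperDefectRankZero_of_nonsurj_of_redDefect_of_katoTam h₃.1 h₃.2.1 h₃.2.2
    (fun W _ _ p _ hr hp2 hadd hT hI hns ↦ h₁ W p hr hp2 hadd hT hI hns)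
    (fun W _ _ p _ hr hp2 hadd hT hI hd ↦ h₂ W p hr hp2 hadd hT hI hd)

end Summit.BirchSwinnertonDyer.BirchSwinnertonDyer.Theorems

end
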